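import Summits.Ventures.PercRepro.RankLevelSetFrameQ
import Summits.Ventures.PercRepro.MatroidColoopWindow
import Summits.Ventures.PercRepro.RankLevelSetPlaneSix
import Summits.Ventures.PercRepro.S1CoreDelete

/-!
# PercRepro — THE COLOOP LADDER FOR THE LEVEL-`4` CELLS (p2, gen 21; SUBCLAIM-S1 §6.5)

A coloop `e` of `M` leaves `#U` unchanged and DOUBLES the middle count up to the two end levels (typer-2's
`topCount_eq_of_isColoop_of_eRank`, night-1's `midCount_eq_of_isColoop_q`: `#Y_M(r+1, 4) = 2·#Y_{M'}(r, 4) + W_r + W_4`,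
`M' = M ＼ {e}`). Since the ranks `≤ 3`, `= 4`, `4 < ρ < r`, `= r` partition the `2^{n'}` subsets of `M'`,
`W_r + W_4 = 2^{n'} − W_{≤3} − #Y_{M'}`, so EXACTLY `#Y_M(r+1, 4) + W_{≤3}(M') = #Y_{M'}(r, 4) + 2^{n'}` — a coloop adds
`2^{n'}` to the `Y`-side, less the sets of rank `≤ 3` (at most `Σ_{i≤6} C(n', i)` on the core: planes have `≤ 6` points).
Iterated over all `c` coloops of a core of rank `p + c`, the cell reduces to the COLOOP-FREE part `N` (rank `p`,
`n − c` points, the same nullity) with `#Y_M ≥ #Y_N + Σ_{j<c} (2^{n−1−j} − W₃⁺(n−1−j))`, and `#U_M = #U_N`.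
The lossy form keeps only `W_r ≥ #U`, `W_4 ≥ #U`: `#Y_M ≥ 2·#Y_{M'} + 2·#U`, so a core with `c` coloops and
`2(2^c − 1) ≥ Φ(p + c, 4)` satisfies `RLS` outright.

* `lowCount`, `two_pow_ncard_eq` — the partition of the subsets by rank;
* `lowCount_three_le_of_free` — `W_{≤3} ≤ Σ_{i≤6} C(n, i)` on the core;
* `coloops_delete_singleton_of_isColoop` — `(M ＼ {e}).coloops = M.coloops \ {e}` for a coloop `e`;
* `midCount_add_lowCount_of_isColoop` — the exact step; `two_mul_midCount_add_le_of_isColoop` — the lossy step;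
* **`ladder_exact`**, **`ladder_lossy`** — the iterated forms.
Axioms: standard.
-/

open scoped Matroid

namespace PercRepro

namespace S1

open Set

variable {α : Type}

/-- `W_{≤k}(M) = #{A ⊆ E : ρ(A) ≤ k}`. -/
noncomputable def lowCount (M : Matroid α) (k : ℕ) : ℕ :=
  {A : Set α | A ⊆ M.E ∧ M.eRk A ≤ (k : ℕ∞)}.ncard

/-- **The subsets of a matroid of rank `r > 4`, partitioned by rank**: `2^n = W_{≤3} + W_4 + #Y(r, 4) + W_r`. -/
theorem two_pow_ncard_eq (M : Matroid α) [M.Finite] {r : ℕ} (hR : M.eRank = (r : ℕ∞)) (hr : 4 < r) :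
    2 ^ M.E.ncard = lowCount M 3 + Matroid.levelCount M 4 + Matroid.midCount M r 4 + Matroid.levelCount M r := by
  classical
  have hfin : (𝒫 M.E).Finite := M.ground_finite.powerset
  set S1 := {A : Set α | A ⊆ M.E ∧ M.eRk A ≤ ((3 : ℕ) : ℕ∞)} with hS1
  set S2 := {A : Set α | A ⊆ M.E ∧ M.eRk A = ((4 : ℕ) : ℕ∞)} with hS2
  set S3 := {A : Set α | A ⊆ M.E ∧ ((4 : ℕ) : ℕ∞) < M.eRk A ∧ M.eRk A < (r : ℕ∞)} with hS3
  set S4 := {A : Set α | A ⊆ M.E ∧ M.eRk A = (r : ℕ∞)} with hS4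
  have hcover : 𝒫 M.E = S1 ∪ (S2 ∪ (S3 ∪ S4)) := by
    ext A
    simp only [mem_powerset_iff, mem_union, hS1, hS2, hS3, hS4, mem_setOf_eq]
    constructor
    · intro hA
      have hle : M.eRk A ≤ (r : ℕ∞) := by rw [← hR]; exact M.eRk_le_eRank A
      have hne : M.eRk A ≠ ⊤ := ne_top_of_le_ne_top (ENat.coe_ne_top r) hle
      obtain ⟨k, hk⟩ := ENat.ne_top_iff_exists.1 hne
      rw [← hk] at hle ⊢
      have hkr : k ≤ r := by exact_mod_cast hle
      rcases Nat.lt_or_ge k 4 with h3 | h4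
      · exact Or.inl ⟨hA, by exact_mod_cast (show k ≤ 3 by omega)⟩
      rcases Nat.eq_or_lt_of_le h4 with h4' | h4'
      · exact Or.inr (Or.inl ⟨hA, by rw [← h4']⟩)
      rcases Nat.lt_or_ge k r with hlt | hge
      · exact Or.inr (Or.inr (Or.inl ⟨hA, by exact_mod_cast h4', by exact_mod_cast hlt⟩))
      · exact Or.inr (Or.inr (Or.inr ⟨hA, by congr 1; omega⟩))
    · rintro (h | h | h | h) <;> exact h.1
  have hsub1 : S1 ⊆ 𝒫 M.E := fun A hA => hA.1
  have hsub2 : S2 ⊆ 𝒫 M.E := fun A hA => hA.1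
  have hsub3 : S3 ⊆ 𝒫 M.E := fun A hA => hA.1
  have hsub4 : S4 ⊆ 𝒫 M.E := fun A hA => hA.1
  have hd34 : Disjoint S3 S4 := by
    rw [Set.disjoint_left]
    rintro A ⟨-, -, h2⟩ ⟨-, h3⟩
    rw [h3] at h2
    exact lt_irrefl _ h2
  have hd2 : Disjoint S2 (S3 ∪ S4) := by
    rw [Set.disjoint_left]
    rintro A ⟨-, h2⟩ (⟨-, h3, -⟩ | ⟨-, h3⟩)
    · rw [h2] at h3; exact lt_irrefl _ h3
    · rw [h2] at h3
      have : (4 : ℕ) = r := by exact_mod_cast h3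
      omega
  have hd1 : Disjoint S1 (S2 ∪ (S3 ∪ S4)) := by
    rw [Set.disjoint_left]
    rintro A ⟨-, h1⟩ (⟨-, h2⟩ | ⟨-, h3, -⟩ | ⟨-, h4⟩)
    · rw [h2] at h1
      have : (4 : ℕ) ≤ 3 := by exact_mod_cast h1
      omega
    · exact absurd (h1.trans_lt' h3) (by
        have : ((3 : ℕ) : ℕ∞) < ((4 : ℕ) : ℕ∞) := by exact_mod_cast (by norm_num : (3 : ℕ) < 4)
        exact fun h => lt_irrefl _ (this.trans h))
    · rw [h4] at h1
      have : r ≤ 3 := by exact_mod_cast h1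
      omega
  have h1 := Set.ncard_union_eq hd1 (hfin.subset hsub1) (hfin.subset (Set.union_subset hsub2 (Set.union_subset hsub3 hsub4)))
  have h2 := Set.ncard_union_eq hd2 (hfin.subset hsub2) (hfin.subset (Set.union_subset hsub3 hsub4))
  have h3 := Set.ncard_union_eq hd34 (hfin.subset hsub3) (hfin.subset hsub4)
  rw [← Set.ncard_powerset M.E M.ground_finite, hcover, h1, h2, h3]
  unfold lowCount Matroid.levelCount Matroid.midCount
  simp only [hS1, hS2, hS3, hS4]
  push_cast
  ring

/-- The subsets of a finite set with at most `k` elements number `Σ_{i≤k} C(n, i)`. -/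
theorem ncard_subsets_ncard_le {s : Set α} (hs : s.Finite) (k : ℕ) :
    {t : Set α | t ⊆ s ∧ t.ncard ≤ k}.ncard = ∑ i ∈ Finset.range (k + 1), s.ncard.choose i := by
  classical
  induction k with
  | zero =>
    rw [Finset.sum_range_one, ← Set.ncard_powerset_ncard hs 0]
    congr 1
    ext t
    simp only [mem_setOf_eq, Nat.le_zero]
  | succ k ih =>
    rw [Finset.sum_range_succ, ← ih, ← Set.ncard_powerset_ncard hs (k + 1)]
    have hsplit : {t : Set α | t ⊆ s ∧ t.ncard ≤ k + 1} =
        {t : Set α | t ⊆ s ∧ t.ncard ≤ k} ∪ {t : Set α | t ⊆ s ∧ t.ncard = k + 1} := by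
      ext t
      simp only [mem_setOf_eq, mem_union]
      constructor
      · rintro ⟨ht, hk⟩
        rcases Nat.lt_or_ge t.ncard (k + 1) with h | h
        · exact Or.inl ⟨ht, by omega⟩
        · exact Or.inr ⟨ht, by omega⟩
      · rintro (⟨ht, hk⟩ | ⟨ht, hk⟩)
        · exact ⟨ht, by omega⟩
        · exact ⟨ht, by omega⟩
    have hdisj : Disjoint {t : Set α | t ⊆ s ∧ t.ncard ≤ k} {t : Set α | t ⊆ s ∧ t.ncard = k + 1} := by
      rw [Set.disjoint_left]
      rintro t ⟨-, h1⟩ ⟨-, h2⟩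
      omega
    rw [hsplit, Set.ncard_union_eq hdisj (hs.finite_subsets.subset fun t ht => ht.1)
      (hs.finite_subsets.subset fun t ht => ht.1)]

/-- **`W_{≤3} ≤ Σ_{i≤6} C(n, i)` on the `e`-free core**: a set of rank `≤ 3` has at most `6` points. -/
theorem lowCount_three_le_of_free (M : Matroid α) [M.Finite]
    (hfree : ∀ e ∈ M.E, ∃ A ⊆ M.E \ {e}, e ∉ M.closure A ∧ e ∉ M.closure ((M.E \ {e}) \ A)) :
    lowCount M 3 ≤ ∑ i ∈ Finset.range 7, M.E.ncard.choose i := by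
  rw [← ncard_subsets_ncard_le M.ground_finite 6]
  unfold lowCount
  apply Set.ncard_le_ncard
  · rintro A ⟨hA, hr⟩
    exact ⟨hA, ThmN.ncard_le_six_of_eRk_le_three_of_free M hfree hA hr⟩
  · exact M.ground_finite.finite_subsets.subset fun t ht => ht.1

/-- **The coloops of `M ＼ {e}` for a coloop `e`** are the other coloops of `M`. -/
theorem coloops_delete_singleton_of_isColoop (M : Matroid α) {e : α} (he : M.IsColoop e) :
    (M ＼ {e}).coloops = M.coloops \ {e} := by
  rw [← Matroid.contract_eq_delete_of_subset_coloops (Set.singleton_subset_iff.2 he),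
    Matroid.contract_coloops_eq]

/-- **The exact coloop step**: `e` a coloop, `r(M) = r + 1 > 5` ⇒ `#Y_M(r+1, 4) + W_{≤3}(M ＼ {e}) = #Y_{M ＼ {e}}(r, 4) + 2^{n−1}`. -/
theorem midCount_add_lowCount_of_isColoop (M : Matroid α) [M.Finite] {e : α} (he : M.IsColoop e)
    {r : ℕ} (hR : M.eRank = ((r + 1 : ℕ) : ℕ∞)) (hr : 4 < r) :
    Matroid.midCount M (r + 1) 4 + lowCount (M ＼ {e}) 3 =
      Matroid.midCount (M ＼ {e}) r 4 + 2 ^ (M ＼ {e}).E.ncard := by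
  have h := Matroid.midCount_eq_of_isColoop_q he (p := r) (q := 3) (by omega)
  have h2 := two_pow_ncard_eq (M ＼ {e}) (r := r) (Matroid.eRank_delete_eq he hR) hr
  norm_num at h
  omega

/-- **The lossy coloop step**: `#Y_M(r+1, 4) ≥ 2·#Y_{M ＼ {e}}(r, 4) + 2·#U_{M ＼ {e}}(r, 4)`. -/
theorem two_mul_midCount_add_le_of_isColoop (M : Matroid α) [M.Finite] {e : α} (he : M.IsColoop e)
    {r : ℕ} (hr : 4 < r) :
    2 * Matroid.midCount (M ＼ {e}) r 4 + 2 * Matroid.topCount (M ＼ {e}) r 4 ≤ Matroid.midCount M (r + 1) 4 := by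
  have h := Matroid.midCount_eq_of_isColoop_q he (p := r) (q := 3) (by omega)
  have h1 := Matroid.topCount_le_levelCount_top (M := M ＼ {e}) r 4
  have h2 := Matroid.topCount_le_levelCount_bot (M := M ＼ {e}) r 4
  norm_num at h
  omega

/-- `W₃⁺(m) = Σ_{i≤6} C(m, i)`, the crude bound on the sets of rank `≤ 3` of a core on `m` points. -/
def w3plus (m : ℕ) : ℕ := ∑ i ∈ Finset.range 7, m.choose i

/-- **THE EXACT LADDER**: a finite `e`-free core `M` of rank `p + c` (`p > 4`) with at least `c` coloops has a
sub-core `N` (`c` coloops deleted: rank `p`, `|E| − c` points, `c` coloops fewer, `e`-free) with `#U_M(p+c, 4) = #U_N(p, 4)`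
and `#Y_N(p, 4) + Σ_{j<c} 2^{n−1−j} ≤ #Y_M(p+c, 4) + Σ_{j<c} W₃⁺(n − 1 − j)` (`n = |E(M)|`). -/
theorem ladder_exact (c : ℕ) : ∀ (M : Matroid α) [M.Finite] (p : ℕ), M.eRank = ((p + c : ℕ) : ℕ∞) → 4 < p →
    c ≤ M.coloops.ncard →
    (∀ e ∈ M.E, ∃ A ⊆ M.E \ {e}, e ∉ M.closure A ∧ e ∉ M.closure ((M.E \ {e}) \ A)) →
    ∃ (N : Matroid α) (_ : N.Finite), N.eRank = (p : ℕ∞) ∧ N.E.ncard + c = M.E.ncard ∧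
      N.coloops.ncard + c = M.coloops.ncard ∧
      (∀ e ∈ N.E, ∃ A ⊆ N.E \ {e}, e ∉ N.closure A ∧ e ∉ N.closure ((N.E \ {e}) \ A)) ∧
      Matroid.topCount M (p + c) 4 = Matroid.topCount N p 4 ∧
      Matroid.midCount N p 4 + ∑ j ∈ Finset.range c, 2 ^ (M.E.ncard - 1 - j) ≤
        Matroid.midCount M (p + c) 4 + ∑ j ∈ Finset.range c, w3plus (M.E.ncard - 1 - j) := by
  induction c with
  | zero =>
    intro M _ p hR hp hc hfree
    exact ⟨M, inferInstance, by simpa using hR, by simp, by simp, hfree, rfl, by simp⟩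
  | succ c ih =>
    intro M _ p hR hp hc hfree
    -- a coloop `e`
    have hKfin : M.coloops.Finite := M.ground_finite.subset M.coloops_subset_ground
    obtain ⟨e, he⟩ : M.coloops.Nonempty := by
      rw [← Set.ncard_pos hKfin]; omega
    have he' : M.IsColoop e := he
    have heE : e ∈ M.E := he'.mem_ground
    -- the deletion: rank `p + c`, one coloop fewer, one point fewer, `e`-free
    have hR1 : M.eRank = ((p + c + 1 : ℕ) : ℕ∞) := by rw [hR, ← Nat.add_assoc]
    have hR' : (M ＼ {e}).eRank = ((p + c : ℕ) : ℕ∞) := Matroid.eRank_delete_eq he' hR1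
    have hcol' : (M ＼ {e}).coloops.ncard + 1 = M.coloops.ncard := by
      rw [coloops_delete_singleton_of_isColoop M he']
      exact Set.ncard_sdiff_singleton_add_one he hKfin
    have hn' : (M ＼ {e}).E.ncard + 1 = M.E.ncard := by
      rw [Matroid.delete_ground]
      exact Set.ncard_sdiff_singleton_add_one heE M.ground_finite
    have hfree' := hfree_delete M hfree e
    obtain ⟨N, hNfin, hNR, hNn, hNcol, hNfree, hNtop, hNmid⟩ :=
      ih (M ＼ {e}) p hR' hp (by omega) hfree'
    refine ⟨N, hNfin, hNR, by omega, by omega, hNfree, ?_, ?_⟩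
    · rw [← hNtop]
      have h := Matroid.topCount_eq_of_isColoop_of_eRank he' 3 (p := p + c) hR1
      norm_num at h
      rw [show p + (c + 1) = p + c + 1 by ring]
      exact h
    · have hstep := midCount_add_lowCount_of_isColoop M he' (r := p + c) hR1 (by omega)
      have hlow := lowCount_three_le_of_free (M ＼ {e}) hfree'
      set n := M.E.ncard with hn
      have hn1 : (M ＼ {e}).E.ncard = n - 1 := by omega
      rw [hn1] at hNmid hlow hstep
      have hs1 : ∑ j ∈ Finset.range (c + 1), 2 ^ (n - 1 - j) =
          2 ^ (n - 1) + ∑ j ∈ Finset.range c, 2 ^ (n - 1 - 1 - j) := by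
        rw [Finset.sum_range_succ', Nat.sub_zero, add_comm]
        congr 1
        exact Finset.sum_congr rfl fun j _ => by rw [show n - 1 - (j + 1) = n - 1 - 1 - j by omega]
      have hs2 : ∑ j ∈ Finset.range (c + 1), w3plus (n - 1 - j) =
          w3plus (n - 1) + ∑ j ∈ Finset.range c, w3plus (n - 1 - 1 - j) := by
        rw [Finset.sum_range_succ', Nat.sub_zero, add_comm]
        congr 1
        exact Finset.sum_congr rfl fun j _ => by rw [show n - 1 - (j + 1) = n - 1 - 1 - j by omega]
      rw [hs1, hs2, show p + (c + 1) = p + c + 1 by ring]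
      have hlow' : lowCount (M ＼ {e}) 3 ≤ w3plus (n - 1) := hlow
      omega

/-- **THE LOSSY LADDER**: a finite matroid `M` of rank `p + c` (`p > 4`) with at least `c` coloops has a sub-matroid `N`
of rank `p` with `#U_M(p+c, 4) = #U_N(p, 4)` and `2^c·#Y_N(p, 4) + 2(2^c − 1)·#U_N(p, 4) ≤ #Y_M(p+c, 4)`. -/
theorem ladder_lossy (c : ℕ) : ∀ (M : Matroid α) [M.Finite] (p : ℕ), M.eRank = ((p + c : ℕ) : ℕ∞) → 4 < p →
    c ≤ M.coloops.ncard →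
    ∃ (N : Matroid α) (_ : N.Finite), N.eRank = (p : ℕ∞) ∧
      Matroid.topCount M (p + c) 4 = Matroid.topCount N p 4 ∧
      2 ^ c * Matroid.midCount N p 4 + 2 * (2 ^ c - 1) * Matroid.topCount N p 4 ≤ Matroid.midCount M (p + c) 4 := by
  induction c with
  | zero =>
    intro M _ p hR hp hc
    exact ⟨M, inferInstance, by simpa using hR, rfl, by simp⟩
  | succ c ih =>
    intro M _ p hR hp hc
    have hKfin : M.coloops.Finite := M.ground_finite.subset M.coloops_subset_ground
    obtain ⟨e, he⟩ : M.coloops.Nonempty := by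
      rw [← Set.ncard_pos hKfin]; omega
    have he' : M.IsColoop e := he
    have hR1 : M.eRank = ((p + c + 1 : ℕ) : ℕ∞) := by rw [hR, ← Nat.add_assoc]
    have hR' : (M ＼ {e}).eRank = ((p + c : ℕ) : ℕ∞) := Matroid.eRank_delete_eq he' hR1
    have hcol' : (M ＼ {e}).coloops.ncard + 1 = M.coloops.ncard := by
      rw [coloops_delete_singleton_of_isColoop M he']
      exact Set.ncard_sdiff_singleton_add_one he hKfin
    obtain ⟨N, hNfin, hNR, hNtop, hNmid⟩ := ih (M ＼ {e}) p hR' hp (by omega)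
    refine ⟨N, hNfin, hNR, ?_, ?_⟩
    · rw [← hNtop]
      have h := Matroid.topCount_eq_of_isColoop_of_eRank he' 3 (p := p + c) hR1
      norm_num at h
      rw [show p + (c + 1) = p + c + 1 by ring]
      exact h
    · have hstep := two_mul_midCount_add_le_of_isColoop M he' (r := p + c) (by omega)
      rw [show p + (c + 1) = p + c + 1 by ring, pow_succ]
      rw [hNtop] at hstep
      have hX : 1 ≤ 2 ^ c := Nat.one_le_two_pow
      set X := 2 ^ c with hXdef
      set A := Matroid.midCount N p 4
      set T := Matroid.topCount N p 4
      set B := Matroid.midCount (M ＼ {e}) (p + c) 4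
      set C := Matroid.midCount M (p + c + 1) 4
      have h1 : 2 * (X * 2 - 1) * T = 2 * (2 * (X - 1) * T) + 2 * T := by
        have : X * 2 - 1 = 2 * (X - 1) + 1 := by omega
        rw [this]; ring
      have h2 : X * 2 * A = 2 * (X * A) := by ring
      rw [h1, h2]
      omega

/-- **`RLS` FROM MANY COLOOPS ALONE**: a finite matroid of rank `p + c` (`p > 4`) with `c` coloops and
`Φ(p + c, 4) ≤ 2(2^c − 1)` satisfies `RLS` at level `4`. -/
theorem rls_of_coloops_lossy (M : Matroid α) [M.Finite] {p c : ℕ} (hR : M.eRank = ((p + c : ℕ) : ℕ∞))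
    (hp : 4 < p) (hc : c ≤ M.coloops.ncard) (hΦ : phiK (p + c) 4 ≤ 2 * ((2 : ℚ) ^ c - 1)) :
    ThmN.RLS M (p + c) 4 := by
  obtain ⟨N, hNfin, -, hNtop, hNmid⟩ := ladder_lossy c M p hR hp hc
  rw [ThmN.RLS_iff, hNtop]
  have hX : 1 ≤ 2 ^ c := Nat.one_le_two_pow
  have hmidQ : (2 : ℚ) * ((2 : ℚ) ^ c - 1) * (Matroid.topCount N p 4 : ℚ) ≤ (Matroid.midCount M (p + c) 4 : ℚ) := by
    have h : ((2 * (2 ^ c - 1) * Matroid.topCount N p 4 : ℕ) : ℚ) ≤ ((Matroid.midCount M (p + c) 4 : ℕ) : ℚ) := by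
      exact_mod_cast (le_trans (Nat.le_add_left _ _) hNmid)
    rw [Nat.cast_mul, Nat.cast_mul, Nat.cast_sub hX] at h
    push_cast at h
    linarith
  have hT : (0 : ℚ) ≤ (Matroid.topCount N p 4 : ℚ) := by positivity
  nlinarith [mul_le_mul_of_nonneg_right hΦ hT]

end S1

end PercRepro
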